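import Summits.Ventures.CertifiedManyBodySolver.Observables.PairODLROCeilingTL
import Summits.Ventures.CertifiedManyBodySolver.Observables.PairWordD4
import Summits.Ventures.CertifiedManyBodySolver.Rows.DopedTLCorr
import HarnessLib

/-!
# The pair-ODLRO ceiling from `D₄`-ORBIT rows (leg-J certificates): every rotated copy of the box pair word
# dominates `|B|² · m_d²`

HONEST FRAMING: first certified bounds on pairing observables; not a superconductivity verdict; every
number certified (two lineages + referee) or labelled float. Crew hubbard-obs (D-0042), seat hubbard-obs-p1
(`prover-hubbard-obs-p1-g0-0`). Theorem-only; zero compute; no named fact; no `sorry`. Companion of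
`Observables/PairODLROCeilingTL.lean` (plain rows) and `Observables/PairWordD4.lean` (transport of the pair
words): the point-group-reduced certificates of rung 0b-lite (leg J = SU(2) × D₄, λ-form,
`Rows/DopedTLCorrLambdaOrbit.lean`) conclude `SquareTTPrimeCorrOrbitLowerRow … S Λ (−pairBoxWord B)`, a bound
on the `S`-orbit MEAN of the rotated copies `Re ω_{γΛ}(Γ(d4Emb γ 0 Λ)(pairBoxWord B))`. Here:

* `expect_d4Emb_pair_mul` — in ANY window `Λ' ⊇ pairRegion x ∪ pairRegion y`:
  `ω_{γΛ'+w}(Γ(d4Emb γ w Λ')(Γ Φ_x† · Γ Φ_y)) = ω.dWavePairCorr (γx + w) (γy + w)`;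
* `expect_d4Emb_pairBoxWord` — `ω(Γ(d4Emb γ w Λ_B)(pairBoxWord B)) = Σ_{x,y∈B} ω.dWavePairCorr (γx + w) (γy + w)`
  `= Σ_{x',y' ∈ γB+w} ω.dWavePairCorr x' y'`;
* `sq_card_mul_braggWeight_le_re_expect_d4Emb_pairBoxWord` — for translation-invariant `ω` and any finite
  measure `μ` representing `r ↦ ω.dWavePairCorr 0 r`: `|B|² · braggWeight μ ![0] ≤ Re ω(Γ(d4Emb γ w Λ_B)(pairBoxWord B))`
  for EVERY `γ, w` (the ceiling of `PairODLROCeilingTL` applied to the finite set `γB + w`);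
* `sq_card_mul_braggWeight_le_neg_of_pairBox_orbitLowerRow` / `braggWeight_le_…` — an ORBIT row
  `SquareTTPrimeCorrOrbitLowerRow tp U n u r S Λ_B (−pairBoxWord B)` (energy cap `u`) gives
  `|B|² · braggWeight μ ![0] ≤ −r` for every torus-limit ground state of the class with `e₀ ≤ u` and every
  representing `μ`: the certified `d`-wave pair-ODLRO CEILING from a leg-J certificate, with NO `D₄`-invariance
  assumption on `ω` or `B`; M3′ form `m3_dWavePair_braggWeight_le_of_orbitLowerRow_neg`.
-/

noncomputable section

namespace Summit.Ventures.CertifiedManyBodySolver.Observables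

open Matrix Literature.MathematicalPhysics.QuantumLattice Literature.Probability.LatticeModels
open Literature.MathematicalPhysics.QuantumLattice.HubbardWave0 ThermodynamicLimit
open MeasureTheory Complex Filter Topology
open scoped BigOperators ComplexOrder

section BoxTransport

/-- **The rotated pair two-point word in any window**: for `Λ' ⊇ pairRegion S x, pairRegion S y`,
`ω_{γΛ'+w}(Γ(d4Emb γ w Λ')(Γ(incl) Φ_x† · Γ(incl) Φ_y)) = ω.dWavePairCorr (γx + w) (γy + w)`.
[cite: Scalapino1995, §2 eq. (2.3)] -/
theorem expect_d4Emb_pair_mul (ω : InfVolFermionState 2) (γ : DihedralGroup 4) (w x y : Site 2)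
    {Λ' : Finset (Site 2)} (hx : pairRegion (insert (0 : Site 2) unitSteps) x ⊆ Λ')
    (hy : pairRegion (insert (0 : Site 2) unitSteps) y ⊆ Λ') :
    ω.expect (d4ShiftSet γ w Λ')
      (fermionEmbed (PolySite.d4Emb γ w Λ')
        (fermionEmbed (PolySite.incl hx) (localPairAt (insert (0 : Site 2) unitSteps) dWaveFormFactor x)ᴴ *
          fermionEmbed (PolySite.incl hy) (localPairAt (insert (0 : Site 2) unitSteps) dWaveFormFactor y))) =
      ω.dWavePairCorr (d4Vec γ x + w) (d4Vec γ y + w) := by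
  rw [map_mul, fermionEmbed_d4Emb_fermionEmbed_incl, fermionEmbed_d4Emb_fermionEmbed_incl,
    fermionEmbed_conjTranspose, fermionEmbed_d4Emb_localPairAt_dWave, fermionEmbed_d4Emb_localPairAt_dWave,
    Matrix.conjTranspose_smul, fermionEmbed_smul, fermionEmbed_smul, ← fermionEmbed_conjTranspose,
    fermionEmbed_fermionEmbed, fermionEmbed_fermionEmbed, PolySite.incl_trans, PolySite.incl_trans,
    Matrix.smul_mul, Matrix.mul_smul, smul_smul, map_smul]
  have hχ : star (((b1gSign γ : ℝ)) : ℂ) * (((b1gSign γ : ℝ)) : ℂ) = 1 := by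
    rw [Complex.star_def, Complex.conj_ofReal, ← Complex.ofReal_mul, b1gSign_mul_self, Complex.ofReal_one]
  rw [hχ, one_smul]
  exact (ω.corr_eq_expect_of_subset _ _ _ _).symm

/-- **The rotated box pair word**: `ω(Γ(d4Emb γ w Λ_B)(pairBoxWord B)) = Σ_{x,y∈B} ω.dWavePairCorr (γx + w) (γy + w)`
(`Λ_B = ⋃_{x∈B} pairRegion S x`). [cite: Scalapino1995, §2 eq. (2.4)] -/
theorem expect_d4Emb_pairBoxWord (ω : InfVolFermionState 2) (γ : DihedralGroup 4) (w : Site 2) (B : Finset (Site 2)) :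
    ω.expect (d4ShiftSet γ w (B.biUnion (pairRegion (insert (0 : Site 2) unitSteps))))
      (fermionEmbed (PolySite.d4Emb γ w _) (pairBoxWord (insert (0 : Site 2) unitSteps) dWaveFormFactor B)) =
      ∑ x ∈ B, ∑ y ∈ B, ω.dWavePairCorr (d4Vec γ x + w) (d4Vec γ y + w) := by
  unfold pairBoxWord
  rw [map_sum, map_sum]
  have hx : ∀ x ∈ B.attach, ω.expect (d4ShiftSet γ w (B.biUnion (pairRegion (insert (0 : Site 2) unitSteps))))
      (fermionEmbed (PolySite.d4Emb γ w _) (∑ y ∈ B.attach,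
        fermionEmbed (PolySite.incl (Finset.subset_biUnion_of_mem (pairRegion (insert (0 : Site 2) unitSteps)) x.2))
            (localPairAt (insert (0 : Site 2) unitSteps) dWaveFormFactor x)ᴴ *
          fermionEmbed (PolySite.incl (Finset.subset_biUnion_of_mem (pairRegion (insert (0 : Site 2) unitSteps)) y.2))
            (localPairAt (insert (0 : Site 2) unitSteps) dWaveFormFactor y))) =
      ∑ y ∈ B.attach, ω.dWavePairCorr (d4Vec γ x + w) (d4Vec γ y + w) := by
    intro x _
    rw [map_sum, map_sum]
    exact Finset.sum_congr rfl fun y _ => expect_d4Emb_pair_mul ω γ w x y _ _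
  rw [Finset.sum_congr rfl hx,
    Finset.sum_attach B (fun x => ∑ y ∈ B.attach, ω.dWavePairCorr (d4Vec γ x + w) (d4Vec γ (y : Site 2) + w))]
  exact Finset.sum_congr rfl fun x _ =>
    Finset.sum_attach B (fun y => ω.dWavePairCorr (d4Vec γ x + w) (d4Vec γ y + w))

/-- Real parts: `Re ω(Γ(d4Emb γ w Λ_B)(pairBoxWord B)) = Σ_{x,y∈B} Re ω.dWavePairCorr (γx + w) (γy + w)`. -/
theorem re_expect_d4Emb_pairBoxWord (ω : InfVolFermionState 2) (γ : DihedralGroup 4) (w : Site 2)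
    (B : Finset (Site 2)) :
    (ω.expect (d4ShiftSet γ w (B.biUnion (pairRegion (insert (0 : Site 2) unitSteps))))
      (fermionEmbed (PolySite.d4Emb γ w _) (pairBoxWord (insert (0 : Site 2) unitSteps) dWaveFormFactor B))).re =
      ∑ x ∈ B, ∑ y ∈ B, (ω.dWavePairCorr (d4Vec γ x + w) (d4Vec γ y + w)).re := by
  rw [expect_d4Emb_pairBoxWord, Complex.re_sum]
  exact Finset.sum_congr rfl fun x _ => Complex.re_sum _ _

/-- The double sum over `B` at rotated sites is the double sum over the image set `γB + w`. -/
theorem sum_sum_re_dWavePairCorr_d4Vec (ω : InfVolFermionState 2) (γ : DihedralGroup 4) (w : Site 2)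
    (B : Finset (Site 2)) :
    ∑ x ∈ B, ∑ y ∈ B, (ω.dWavePairCorr (d4Vec γ x + w) (d4Vec γ y + w)).re =
      ∑ x' ∈ B.image (fun x => d4Vec γ x + w), ∑ y' ∈ B.image (fun x => d4Vec γ x + w),
        (ω.dWavePairCorr x' y').re := by
  have hinj : Set.InjOn (fun x : Site 2 => d4Vec γ x + w) ↑B := fun a _ b _ h =>
    d4Vec_injective γ (add_right_cancel h)
  rw [Finset.sum_image hinj]
  exact Finset.sum_congr rfl fun x _ => by rw [Finset.sum_image hinj]

/-- **Every rotated copy of the box pair word dominates `|B|² · m_d²`**: for a translation-invariant `ω`,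
any finite measure `μ` representing `r ↦ ω.dWavePairCorr 0 r`, every `γ ∈ D₄`, `w ∈ ℤ²` and finite `B`,
`|B|² · braggWeight μ ![0] ≤ Re ω(Γ(d4Emb γ w Λ_B)(pairBoxWord B))`. [cite: Sewell1970, §4 (Thm. 4.3)] -/
theorem sq_card_mul_braggWeight_le_re_expect_d4Emb_pairBoxWord {ω : InfVolFermionState 2}
    (hω : ω.IsTranslationInvariant) (μ : Measure (EuclideanSpace ℝ (Fin 2))) [IsFiniteMeasure μ]
    (hμ : ∀ r : Site 2, ∫ ξ, exp ((∑ i, (r i : ℝ) * ξ i : ℝ) * I) ∂μ = ω.dWavePairCorr 0 r)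
    (γ : DihedralGroup 4) (w : Site 2) (B : Finset (Site 2)) :
    ((B.card : ℝ)) ^ 2 * braggWeight μ ![(0 : Fin 2 → ℝ)] ≤
      (ω.expect (d4ShiftSet γ w (B.biUnion (pairRegion (insert (0 : Site 2) unitSteps))))
        (fermionEmbed (PolySite.d4Emb γ w _) (pairBoxWord (insert (0 : Site 2) unitSteps) dWaveFormFactor B))).re := by
  rw [re_expect_d4Emb_pairBoxWord, sum_sum_re_dWavePairCorr_d4Vec]
  have hcard : (B.image (fun x => d4Vec γ x + w)).card = B.card :=
    Finset.card_image_of_injOn fun a _ b _ h => d4Vec_injective γ (add_right_cancel h)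
  have h := sq_card_mul_braggWeight_le_sum_re_dWavePairCorr hω μ hμ (B.image (fun x => d4Vec γ x + w))
  rwa [hcard] at h

end BoxTransport

/-! ## The ceiling from an ORBIT row -/

section OrbitRow

/-- **Orbit row on `−pairBoxWord B` ⇒ pair-ODLRO ceiling.** A `D₄`-orbit LOWER row (label set `S`,
nonempty) on the NEGATED box pair word, `SquareTTPrimeCorrOrbitLowerRow tp U n u r S Λ_B (−pairBoxWord B)`
(the shape produced by a leg-J λ-form certificate with `λ < 0`,
`SquareTTPrimeCorrOrbitLowerRow.of_lambda_certificate_neg`), gives for every torus-limit ground state of the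
class with `energyDensityTT' 1 tp U n ≤ u` and every finite measure `μ` representing its `d`-wave pair two-point
function: `|B|² · braggWeight μ ![0] ≤ −r`. No invariance of `ω` or `B` under `D₄` is assumed (each rotated
copy dominates separately). [cite: Sewell1970, §4 (Thm. 4.3)] -/
theorem sq_card_mul_braggWeight_le_neg_of_pairBox_orbitLowerRow {tp U n : ℝ} {u r : ℚ}
    {S : Finset (DihedralGroup 4)} (hS : S.Nonempty) {B : Finset (Site 2)}
    (h : SquareTTPrimeCorrOrbitLowerRow tp U n u r S
      (B.biUnion (pairRegion (insert (0 : Site 2) unitSteps)))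
      (-pairBoxWord (insert (0 : Site 2) unitSteps) dWaveFormFactor B))
    (ω : InfVolFermionState 2) (Ls : ℕ → ℕ) (ψ : ∀ L, Fock (Orb (FermionTorus 2 L)))
    (hLs : Tendsto Ls atTop atTop)
    (hψ : ∀ j, IsGroundStateInSector (hubbardTorusTT' (Ls j) 1 tp U) (rectN n (Ls j)) 0 (ψ (Ls j)))
    (hψ1 : ∀ j, star (ψ (Ls j)) ⬝ᵥ ψ (Ls j) = 1) (hω : ω.IsTorusLimitOf ψ Ls)
    (hu : energyDensityTT' 1 tp U n ≤ ((u : ℚ) : ℝ))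
    (μ : Measure (EuclideanSpace ℝ (Fin 2))) [IsFiniteMeasure μ]
    (hμ : ∀ r : Site 2, ∫ ξ, exp ((∑ i, (r i : ℝ) * ξ i : ℝ) * I) ∂μ = ω.dWavePairCorr 0 r) :
    ((B.card : ℝ)) ^ 2 * braggWeight μ ![(0 : Fin 2 → ℝ)] ≤ -((r : ℚ) : ℝ) := by
  have hrow := h ω Ls ψ hLs hψ hψ1 hω hu
  -- each rotated copy dominates `|B|² m²`
  have hdom : ∀ g ∈ S, ((B.card : ℝ)) ^ 2 * braggWeight μ ![(0 : Fin 2 → ℝ)] ≤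
      (ω.expect (d4ShiftSet g 0 (B.biUnion (pairRegion (insert (0 : Site 2) unitSteps))))
        (fermionEmbed (PolySite.d4Emb g 0 _) (pairBoxWord (insert (0 : Site 2) unitSteps) dWaveFormFactor B))).re :=
    fun g _ => sq_card_mul_braggWeight_le_re_expect_d4Emb_pairBoxWord hω.isTranslationInvariant μ hμ g 0 B
  -- the orbit mean of the negated words is `−` the orbit mean
  have hneg : ∑ g ∈ S, (ω.expect (d4ShiftSet g 0 (B.biUnion (pairRegion (insert (0 : Site 2) unitSteps))))
        (fermionEmbed (PolySite.d4Emb g 0 _) (-pairBoxWord (insert (0 : Site 2) unitSteps) dWaveFormFactor B))).re =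
      -∑ g ∈ S, (ω.expect (d4ShiftSet g 0 (B.biUnion (pairRegion (insert (0 : Site 2) unitSteps))))
        (fermionEmbed (PolySite.d4Emb g 0 _) (pairBoxWord (insert (0 : Site 2) unitSteps) dWaveFormFactor B))).re := by
    rw [← Finset.sum_neg_distrib]
    refine Finset.sum_congr rfl fun g _ => ?_
    rw [map_neg, map_neg, Complex.neg_re]
  rw [hneg] at hrow
  have hcard : (0 : ℝ) < (S.card : ℝ) := by exact_mod_cast hS.card_pos
  have hmean : (S.card : ℝ) * (((B.card : ℝ)) ^ 2 * braggWeight μ ![(0 : Fin 2 → ℝ)]) ≤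
      ∑ g ∈ S, (ω.expect (d4ShiftSet g 0 (B.biUnion (pairRegion (insert (0 : Site 2) unitSteps))))
        (fermionEmbed (PolySite.d4Emb g 0 _) (pairBoxWord (insert (0 : Site 2) unitSteps) dWaveFormFactor B))).re := by
    have := Finset.sum_le_sum hdom
    rwa [Finset.sum_const, nsmul_eq_mul] at this
  -- `r ≤ |S|⁻¹ · (−Σ) ⇒ Σ ≤ −r |S|`
  have h2 : ∑ g ∈ S, (ω.expect (d4ShiftSet g 0 (B.biUnion (pairRegion (insert (0 : Site 2) unitSteps))))
        (fermionEmbed (PolySite.d4Emb g 0 _) (pairBoxWord (insert (0 : Site 2) unitSteps) dWaveFormFactor B))).re ≤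
      -((r : ℚ) : ℝ) * (S.card : ℝ) := by
    have hinv : (S.card : ℝ)⁻¹ * (S.card : ℝ) = 1 := inv_mul_cancel₀ hcard.ne'
    have := mul_le_mul_of_nonneg_right hrow hcard.le
    rw [mul_comm ((S.card : ℝ)⁻¹), mul_assoc, hinv, mul_one] at this
    linarith
  nlinarith [hmean, h2, hcard]

/-- Normalised: under the same hypotheses with `B` nonempty, `braggWeight μ ![0] ≤ −r / |B|²`. -/
theorem braggWeight_le_neg_div_of_pairBox_orbitLowerRow {tp U n : ℝ} {u r : ℚ}
    {S : Finset (DihedralGroup 4)} (hS : S.Nonempty) {B : Finset (Site 2)} (hB : B.Nonempty)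
    (h : SquareTTPrimeCorrOrbitLowerRow tp U n u r S
      (B.biUnion (pairRegion (insert (0 : Site 2) unitSteps)))
      (-pairBoxWord (insert (0 : Site 2) unitSteps) dWaveFormFactor B))
    (ω : InfVolFermionState 2) (Ls : ℕ → ℕ) (ψ : ∀ L, Fock (Orb (FermionTorus 2 L)))
    (hLs : Tendsto Ls atTop atTop)
    (hψ : ∀ j, IsGroundStateInSector (hubbardTorusTT' (Ls j) 1 tp U) (rectN n (Ls j)) 0 (ψ (Ls j)))
    (hψ1 : ∀ j, star (ψ (Ls j)) ⬝ᵥ ψ (Ls j) = 1) (hω : ω.IsTorusLimitOf ψ Ls)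
    (hu : energyDensityTT' 1 tp U n ≤ ((u : ℚ) : ℝ))
    (μ : Measure (EuclideanSpace ℝ (Fin 2))) [IsFiniteMeasure μ]
    (hμ : ∀ r : Site 2, ∫ ξ, exp ((∑ i, (r i : ℝ) * ξ i : ℝ) * I) ∂μ = ω.dWavePairCorr 0 r) :
    braggWeight μ ![(0 : Fin 2 → ℝ)] ≤ -((r : ℚ) : ℝ) / ((B.card : ℝ)) ^ 2 := by
  have hpos : 0 < ((B.card : ℝ)) ^ 2 := by
    have : 0 < (B.card : ℝ) := by exact_mod_cast hB.card_pos
    positivity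
  rw [le_div_iff₀ hpos, mul_comm]
  exact sq_card_mul_braggWeight_le_neg_of_pairBox_orbitLowerRow hS h ω Ls ψ hLs hψ hψ1 hω hu μ hμ

/-- **M3′ form** (`U = 8`, `n = 7/8`, hopping `tp`): an `M3CorrOrbitLowerRow tp u r S Λ_B (−pairBoxWord B)` cell
(leg-J certificate, λ-form with `λ < 0`) with the cap discharged by a typed `M3EnergyUpperRow tp hi`, `hi ≤ u`,
gives `braggWeight μ ![0] ≤ −r / |B|²` for every torus-limit ground state of the M3′ class and every measure
representing its `d`-wave pair two-point function — the certified TL ceiling on the `d`-wave pair ODLRO density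
from a POINT-GROUP-REDUCED certificate. HONEST: a ceiling says nothing about the presence of pairing. -/
theorem m3_dWavePair_braggWeight_le_of_orbitLowerRow_neg {tp : ℝ} {u hi r : ℚ}
    {S : Finset (DihedralGroup 4)} (hS : S.Nonempty) {B : Finset (Site 2)} (hB : B.Nonempty)
    (h : M3CorrOrbitLowerRow tp u r S
      (B.biUnion (pairRegion (insert (0 : Site 2) unitSteps)))
      (-pairBoxWord (insert (0 : Site 2) unitSteps) dWaveFormFactor B))
    (hE : M3EnergyUpperRow tp hi) (hhi : hi ≤ u)
    (ω : InfVolFermionState 2) (Ls : ℕ → ℕ) (ψ : ∀ L, Fock (Orb (FermionTorus 2 L)))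
    (hLs : Tendsto Ls atTop atTop)
    (hψ : ∀ j, IsGroundStateInSector (hubbardTorusTT' (Ls j) 1 tp 8) (rectN (7 / 8) (Ls j)) 0 (ψ (Ls j)))
    (hψ1 : ∀ j, star (ψ (Ls j)) ⬝ᵥ ψ (Ls j) = 1) (hω : ω.IsTorusLimitOf ψ Ls)
    (μ : Measure (EuclideanSpace ℝ (Fin 2))) [IsFiniteMeasure μ]
    (hμ : ∀ r : Site 2, ∫ ξ, exp ((∑ i, (r i : ℝ) * ξ i : ℝ) * I) ∂μ = ω.dWavePairCorr 0 r) :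
    braggWeight μ ![(0 : Fin 2 → ℝ)] ≤ -((r : ℚ) : ℝ) / ((B.card : ℝ)) ^ 2 :=
  braggWeight_le_neg_div_of_pairBox_orbitLowerRow hS hB h ω Ls ψ hLs hψ hψ1 hω
    ((show energyDensityTT' 1 tp 8 (7 / 8) ≤ ((hi : ℚ) : ℝ) from hE).trans (by exact_mod_cast hhi)) μ hμ

end OrbitRow

end Summit.Ventures.CertifiedManyBodySolver.Observables

end
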